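import Summits.SmoothPoincare4.SmoothPoincare4.Theses.SymplecticOrigami

/-!
# `OrigamiFoldExistence`, line `round-trace-continuity`: certified models for the crease predicates
# (negative-side support, crux stmt-SmoothPoincare4-7844)

Drefute companion to `Cruxes/OrigamiFoldExistence/Lines/round-trace-continuity.lean`.  Stubs 2–4 of
that skeleton are phrased through two elementary `fderiv` predicates, `CreaseMeanConvexAt g u`
(mean-convexity of the immersed crease `g|S³` at `u` towards the image of the outer collar) and
`IsMeanConvexUnwinding g c r` (jointly smooth collar germs, local diffeomorphisms along `S³`,
mean-convex for `t ∈ [0,1]`, final crease in the round sphere `S_r(c)`).  This file shows in the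
kernel that they are LIVE (neither vacuous nor trivially true) and correctly SIGNED, with the bodies
copied verbatim as local notation:
* `exists_tangentFrame_of_bijective_fderiv` — the frame quantifier `∀ w ⊥ u, Dg(u)·w orthonormal → …`
  is never vacuous once `Dg(u)` is bijective (always supplied by `IsImmersedFakeBall` /
  `IsMeanConvexUnwinding`): orthonormalise inside `Dg(u)(u^⊥)` and pull back;
* `creaseMeanConvexAt_roundModel` — for the polynomial round model `ρ(x) = (2 - ‖x‖²) x` (identity
  on `S³`, same 1-jet there as the inversion `x/‖x‖²`, `D²ρ(u)[w,w] = -2‖w‖²u - 4⟪u,w⟫w`) the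
  inequality reads `3 < 6` (`H(S³) = 3 > 0`): the sign convention is the intended one;
  `creaseMeanConvexAt_comp_isometry` — the predicate is invariant under linear isometries of the
  target (the lead's det-normalisation lemma), so BOTH determinant classes (`ι`: det −1, `R ∘ ι`:
  det +1; Disproof §8) have mean-convex round creases (`creaseMeanConvexAt_isometry_comp_roundModel`);
* `isMeanConvexUnwinding_const_roundModel` — the constant round family IS a mean-convex unwinding
  (`c = 0`, `r = 1`): the conclusion-interface of the hardest stub has a non-junk inhabitant;
  `radius_pos_of_isMeanConvexUnwinding` — and any unwinding has `0 < r` (no degenerate endpoint);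
* `not_creaseMeanConvexAt_id`, `not_isMeanConvexUnwinding_const_id` — the identity germ (the sphere
  seen from OUTSIDE the ball) fails (`3 < 0`) although its crease is round: the mean-convexity clause
  carries content.
Read-back (no misstatement found): with `A = Dg(u)` invertible both sums are frame-independent
traces over `T = A(u^⊥)` and `ℓ(v) = ⟪A⁻¹v,u⟫` is the conormal positive on `A u`, so the predicate is
`⟪H⃗, side of g({‖x‖>1})⟫ > 0`.  Nothing here asserts a Theses statement.
-/

noncomputable section

-- the prescribed namespace `Summit.<P>.<Sub>.…` duplicates `SmoothPoincare4` (P = Sub)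
set_option linter.dupNamespace false

open scoped Manifold ContDiff Topology RealInnerProductSpace
open Set Function

namespace Summit.SmoothPoincare4.SmoothPoincare4.Theorems.OrigamiFoldExistence.Negative

/-- Local notation: the model space `ℝ⁴`. -/
local notation "E4" => EuclideanSpace ℝ (Fin 4)

set_option quotPrecheck false in
/-- Local notation: the body of `CreaseMeanConvexAt g u` of `Lines/round-trace-continuity.lean`,
verbatim. -/
local notation "CreaseMC[" g ", " u "]" =>
  (∀ w : Fin 3 → E4, (∀ i, ⟪w i, u⟫ = 0) → Orthonormal ℝ (fun i => fderiv ℝ g u (w i)) →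
    ∑ i, ‖w i‖ ^ 2 <
      ∑ i, ⟪(fderiv ℝ g u).inverse (fderiv ℝ (fun x => fderiv ℝ g x (w i)) u (w i)), u⟫)

set_option quotPrecheck false in
/-- Local notation: the body of `IsMeanConvexUnwinding g c r` of `Lines/round-trace-continuity.lean`,
verbatim (with `CreaseMeanConvexAt` expanded). -/
local notation "MCUnwinding[" g ", " c ", " r "]" =>
  ((∀ t ∈ Icc (0 : ℝ) 1, ∀ u : E4, ‖u‖ = 1 →
      ContDiffAt ℝ ∞ (Function.uncurry g) (t, u) ∧ Function.Bijective (fderiv ℝ (g t) u) ∧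
        CreaseMC[g t, u]) ∧
    ∀ u : E4, ‖u‖ = 1 → dist (g 1 u) c = r)

/-- Local notation: the polynomial ROUND MODEL `ρ(x) = (2 - ‖x‖²) x` — identity on the unit sphere,
same 1-jet there as the inversion `x ↦ x/‖x‖²` and same second derivative along the sphere. -/
local notation "ρ" => (fun x : E4 => (2 - ‖x‖ ^ 2) • x)

/-- Local notation: the derivative of the round model at `x`, `h ↦ (2 - ‖x‖²) h - 2⟪x,h⟫ x`. -/
local notation "Dρ[" x "]" =>
  (((2 - ‖x‖ ^ 2) • ContinuousLinearMap.id ℝ E4 +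
    ContinuousLinearMap.smulRight (-(2 • innerSL ℝ x)) x : E4 →L[ℝ] E4))

/-! ### Calculus of the round model -/
/-- `Dρ(x) h = (2 - ‖x‖²) h - 2⟪x,h⟫ x`. [folklore] -/
theorem roundModelDeriv_apply (x h : E4) :
    Dρ[x] h = (2 - ‖x‖ ^ 2) • h - (2 * ⟪x, h⟫) • x := by
  simp [sub_eq_add_neg]

/-- `d(2 - ‖x‖²) = -2⟪x, ·⟫`. [folklore] -/
theorem hasFDerivAt_two_sub_norm_sq (x : E4) :
    HasFDerivAt (fun y : E4 => (2 : ℝ) - ‖y‖ ^ 2) (-(2 • innerSL ℝ x)) x := by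
  have h := (hasFDerivAt_const (2 : ℝ) x).sub (hasStrictFDerivAt_norm_sq x).hasFDerivAt
  rw [zero_sub] at h
  exact h

/-- The round model has derivative `Dρ`. [folklore] -/
theorem hasFDerivAt_roundModel (x : E4) : HasFDerivAt ρ (Dρ[x]) x :=
  (hasFDerivAt_two_sub_norm_sq x).smul (hasFDerivAt_id x)

/-- `fderiv` form of `hasFDerivAt_roundModel`. [folklore] -/
theorem fderiv_roundModel (x : E4) : fderiv ℝ ρ x = Dρ[x] :=
  (hasFDerivAt_roundModel x).fderiv

/-- The second-derivative datum of the round model: the derivative of `x ↦ Dρ(x) w`. [folklore] -/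
theorem hasFDerivAt_roundModelDeriv_apply (w u : E4) :
    HasFDerivAt (fun x : E4 => Dρ[x] w)
      ((-(2 • innerSL ℝ u)).smulRight w -
        ((2 * ⟪u, w⟫) • ContinuousLinearMap.id ℝ E4 + ((2 : ℝ) • innerSL ℝ w).smulRight u)) u := by
  have h1 : HasFDerivAt (fun x : E4 => (2 - ‖x‖ ^ 2) • w) ((-(2 • innerSL ℝ u)).smulRight w) u :=
    (hasFDerivAt_two_sub_norm_sq u).smul_const w
  have h2 : HasFDerivAt (fun x : E4 => 2 * ⟪x, w⟫) ((2 : ℝ) • innerSL ℝ w) u := by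
    have : HasFDerivAt (fun x : E4 => ⟪x, w⟫) (innerSL ℝ w) u := by
      have h := (innerSL ℝ w).hasFDerivAt (x := u)
      refine h.congr_of_eventuallyEq ?_
      exact Filter.Eventually.of_forall fun y => by simp [real_inner_comm]
    exact this.const_mul (2 : ℝ)
  have h3 : HasFDerivAt (fun x : E4 => (2 * ⟪x, w⟫) • x)
      ((2 * ⟪u, w⟫) • ContinuousLinearMap.id ℝ E4 + ((2 : ℝ) • innerSL ℝ w).smulRight u) u :=
    h2.smul (hasFDerivAt_id u)
  have h4 := h1.sub h3
  refine h4.congr_of_eventuallyEq (Filter.Eventually.of_forall fun y => ?_)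
  simp [sub_eq_add_neg]

/-- `D²ρ(u)[w,w] = -4⟪u,w⟫ w - 2‖w‖² u` (derivative of `x ↦ Dρ(x) w` at `u`, applied to `w`). [folklore] -/
theorem fderiv_roundModelDeriv_apply_apply_self (w u : E4) :
    fderiv ℝ (fun x : E4 => Dρ[x] w) u w = -(4 * ⟪u, w⟫) • w - (2 * ‖w‖ ^ 2) • u := by
  rw [(hasFDerivAt_roundModelDeriv_apply w u).fderiv]
  simp [ContinuousLinearMap.smulRight_apply, innerSL_apply_apply]
  module

/-- `D²ρ(u)[w,w] = -4⟪u,w⟫ w - 2‖w‖² u`, in the exact `fderiv`-of-`fderiv` form used by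
`CreaseMeanConvexAt`. [folklore] -/
theorem fderiv_roundModelDeriv_apply_self (w u : E4) :
    fderiv ℝ (fun x : E4 => fderiv ℝ ρ x w) u w = -(4 * ⟪u, w⟫) • w - (2 * ‖w‖ ^ 2) • u := by
  have hfun : (fun x : E4 => fderiv ℝ ρ x w) = fun x => Dρ[x] w := by
    funext x; rw [fderiv_roundModel]
  rw [hfun, fderiv_roundModelDeriv_apply_apply_self]

/-! ### On the unit sphere the derivative is the reflection in `u^⊥`, an involution -/
/-- `ρ(u) = u` for `‖u‖ = 1`: the crease of the round model is the round unit sphere. [folklore] -/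
theorem roundModel_apply_of_norm_eq_one {u : E4} (hu : ‖u‖ = 1) : ρ u = u := by
  simp [hu]; norm_num

/-- `Dρ(u) h = h - 2⟪u,h⟫ u` for `‖u‖ = 1` (the reflection in `u^⊥`, as for the inversion). [folklore] -/
theorem roundModelDeriv_apply_of_norm_eq_one {u : E4} (hu : ‖u‖ = 1) (h : E4) :
    Dρ[u] h = h - (2 * ⟪u, h⟫) • u := by
  rw [roundModelDeriv_apply, hu]
  norm_num

/-- `Dρ(u)` is an involution for `‖u‖ = 1`. [folklore] -/
theorem roundModelDeriv_roundModelDeriv {u : E4} (hu : ‖u‖ = 1) (h : E4) :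
    Dρ[u] (Dρ[u] h) = h := by
  rw [roundModelDeriv_apply_of_norm_eq_one hu, roundModelDeriv_apply_of_norm_eq_one hu,
    inner_sub_right, inner_smul_right, real_inner_self_eq_norm_sq, hu]
  module

/-- `(Dρ u).inverse = Dρ u` for `‖u‖ = 1` (a genuine equivalence, no junk zero). [folklore] -/
theorem inverse_roundModelDeriv {u : E4} (hu : ‖u‖ = 1) : (Dρ[u]).inverse = Dρ[u] := by
  have h1 : ((ContinuousLinearEquiv.equivOfInverse (Dρ[u]) (Dρ[u])
      (fun h => roundModelDeriv_roundModelDeriv hu h) (fun h => roundModelDeriv_roundModelDeriv hu h) :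
        E4 ≃L[ℝ] E4) : E4 →L[ℝ] E4) = Dρ[u] := rfl
  rw [← h1, ContinuousLinearMap.inverse_equiv]
  ext h
  rfl

/-- `Dρ(u)` is bijective for `‖u‖ = 1` (the clause `Function.Bijective (fderiv ℝ (g t) u)` of
`IsMeanConvexUnwinding`). [folklore] -/
theorem bijective_fderiv_roundModel {u : E4} (hu : ‖u‖ = 1) : Function.Bijective (fderiv ℝ ρ u) := by
  rw [fderiv_roundModel]
  exact (ContinuousLinearEquiv.equivOfInverse (Dρ[u]) (Dρ[u])
    (fun h => roundModelDeriv_roundModelDeriv hu h)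
    (fun h => roundModelDeriv_roundModelDeriv hu h)).bijective

/-! ### The round crease is mean-convex towards the image of the outer side (`3 < 6`) -/
/-- **The round crease is mean-convex** in the sense of `CreaseMeanConvexAt` (body verbatim): for
the round model the defining inequality reads `3 < 6` — each of the three summands is `1 < 2`, the
classical `H(S³) = 3 > 0` for the side `Dρ(u)u = -u` (the ball), into which the outer collar
`{‖x‖ > 1}` is mapped.  So the skeleton's sign convention is the intended one, and the `t = 0`
hypothesis of `stub_meanConvexUnwinding` holds at the round immersed fake ball of `S⁴`. [folklore] -/
theorem creaseMeanConvexAt_roundModel {u : E4} (hu : ‖u‖ = 1) : CreaseMC[ρ, u] := by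
  intro w hw horth
  have huw : ∀ i, ⟪u, w i⟫ = 0 := fun i => by rw [real_inner_comm]; exact hw i
  have hD : ∀ i, fderiv ℝ ρ u (w i) = w i := by
    intro i
    rw [fderiv_roundModel, roundModelDeriv_apply_of_norm_eq_one hu, huw i]
    simp
  have hw1 : ∀ i, ‖w i‖ = 1 := fun i => by simpa [hD] using horth.1 i
  have hL : ∑ i, ‖w i‖ ^ 2 = (3 : ℝ) := by simp [hw1]
  have hR : ∀ i, ⟪(fderiv ℝ ρ u).inverse (fderiv ℝ (fun x => fderiv ℝ ρ x (w i)) u (w i)), u⟫ =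
      (2 : ℝ) := by
    intro i
    rw [fderiv_roundModelDeriv_apply_self, fderiv_roundModel, inverse_roundModelDeriv hu,
      roundModelDeriv_apply_of_norm_eq_one hu, huw i, hw1 i]
    simp only [inner_sub_right, inner_smul_right, real_inner_self_eq_norm_sq, hu, huw i,
      inner_sub_left, inner_smul_left]
    norm_num
  rw [hL, Finset.sum_congr rfl fun i _ => hR i]
  norm_num

/-- **The constant round family is a mean-convex unwinding** (`IsMeanConvexUnwinding` verbatim,
`c = 0`, `r = 1`): joint `C^∞`, bijective derivative, mean-convex crease, final crease in the unit
sphere — a non-junk inhabitant of the conclusion-interface of `stub_meanConvexUnwinding`. [folklore] -/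
theorem isMeanConvexUnwinding_const_roundModel : MCUnwinding[(fun _ : ℝ => ρ), 0, 1] := by
  refine ⟨fun t _ u hu => ⟨?_, bijective_fderiv_roundModel hu, creaseMeanConvexAt_roundModel hu⟩,
    fun u hu => ?_⟩
  · have hsmooth : ContDiff ℝ ∞ ρ := (contDiff_const.sub (contDiff_norm_sq ℝ)).smul contDiff_id
    exact (hsmooth.comp contDiff_snd).contDiffAt
  · show dist (ρ u) 0 = 1
    rw [roundModel_apply_of_norm_eq_one hu]
    simpa using hu

/-! ### Mean-convexity is invariant under isometries of the target (both determinant classes)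
`CreaseMeanConvexAt` speaks about the mean-curvature VECTOR and the image side, so post-composing the
germ with a linear isometry `L` of `ℝ⁴` preserves it — the lemma the lead needs to normalise the sign of
`det D(F∘e)` by a reflection (PICKED.md), and the reason the det-sign trap of Disproof §8 concerns the
side only.  Corollary: `L ∘ ρ` (e.g. `R ∘ ι`, det `+1`) has a mean-convex round crease too. -/

/-- `ContinuousLinearMap.inverse` of `L ∘ A` on `L v` is `A.inverse v` for a linear isometry `L` — in
BOTH branches of the junk definition (invertible: genuine inverses; not: both sides `0`). [folklore] -/
theorem inverse_isometry_comp_apply (L : E4 ≃ₗᵢ[ℝ] E4) (A : E4 →L[ℝ] E4) (v : E4) :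
    ((L : E4 →L[ℝ] E4).comp A).inverse (L v) = A.inverse v := by
  by_cases hA : A.IsInvertible
  · obtain ⟨e, rfl⟩ := hA
    have h1 : (L : E4 →L[ℝ] E4).comp (e : E4 →L[ℝ] E4) =
        ((e.trans L.toContinuousLinearEquiv : E4 ≃L[ℝ] E4) : E4 →L[ℝ] E4) := by
      ext y; rfl
    rw [h1, ContinuousLinearMap.inverse_equiv, ContinuousLinearMap.inverse_equiv]
    show (e.trans L.toContinuousLinearEquiv).symm (L v) = e.symm v
    rw [ContinuousLinearEquiv.symm_trans_apply]
    show e.symm (L.toContinuousLinearEquiv.symm (L.toContinuousLinearEquiv v)) = e.symm v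
    rw [ContinuousLinearEquiv.symm_apply_apply]
  · have hLA : ¬ ((L : E4 →L[ℝ] E4).comp A).IsInvertible := by
      rintro ⟨e', he'⟩
      apply hA
      refine ⟨e'.trans L.toContinuousLinearEquiv.symm, ContinuousLinearMap.ext fun y => ?_⟩
      have hy : e' y = L (A y) := by
        have := congrArg (fun f : E4 →L[ℝ] E4 => f y) he'
        simpa using this
      show L.toContinuousLinearEquiv.symm (e' y) = A y
      rw [hy]
      exact L.toContinuousLinearEquiv.symm_apply_apply (A y)
    rw [ContinuousLinearMap.inverse_of_not_isInvertible hA,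
      ContinuousLinearMap.inverse_of_not_isInvertible hLA]
    simp

/-- **`CreaseMeanConvexAt` is invariant under linear isometries of the target**: if the germ `g` has
mean-convex crease at `u`, so has `L ∘ g` (chain rule `D(L∘g) = L∘Dg`, `D²(L∘g) = L∘D²g`; frames with
`L(Dg w)` orthonormal are those with `Dg w` orthonormal; the conormal term is unchanged by
`inverse_isometry_comp_apply`).  No differentiability hypothesis is needed (junk branches agree). [folklore] -/
theorem creaseMeanConvexAt_comp_isometry {g : E4 → E4} {u : E4} (L : E4 ≃ₗᵢ[ℝ] E4)
    (h : CreaseMC[g, u]) : CreaseMC[(⇑L ∘ g), u] := by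
  intro w hw horth
  have hfd : fderiv ℝ (⇑L ∘ g) u = (L : E4 →L[ℝ] E4).comp (fderiv ℝ g u) := L.comp_fderiv
  have horth' : Orthonormal ℝ (fun i => fderiv ℝ g u (w i)) := by
    rw [hfd] at horth
    have hcomp : (fun i => ((L : E4 →L[ℝ] E4).comp (fderiv ℝ g u)) (w i)) =
        (L.toLinearIsometry ∘ fun i => fderiv ℝ g u (w i)) := by
      funext i; simp
    rw [hcomp, LinearIsometry.orthonormal_comp_iff] at horth
    exact horth
  have key := h w hw horth'
  have hterm : ∀ i, ⟪(fderiv ℝ (⇑L ∘ g) u).inverse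
      (fderiv ℝ (fun x => fderiv ℝ (⇑L ∘ g) x (w i)) u (w i)), u⟫ =
        ⟪(fderiv ℝ g u).inverse (fderiv ℝ (fun x => fderiv ℝ g x (w i)) u (w i)), u⟫ := by
    intro i
    have h2 : (fun x => fderiv ℝ (⇑L ∘ g) x (w i)) = (⇑L ∘ fun x => fderiv ℝ g x (w i)) := by
      funext x; rw [L.comp_fderiv]; simp
    rw [h2, L.comp_fderiv (f := fun x => fderiv ℝ g x (w i)), ContinuousLinearMap.comp_apply, hfd]
    exact congrArg (fun v => ⟪v, u⟫)
      (inverse_isometry_comp_apply L (fderiv ℝ g u) (fderiv ℝ (fun x => fderiv ℝ g x (w i)) u (w i)))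
  calc ∑ i, ‖w i‖ ^ 2 < _ := key
    _ = _ := Finset.sum_congr rfl fun i _ => (hterm i).symm

/-- **Mean-convexity of the round crease in BOTH determinant classes**: for every linear isometry `L`
of `ℝ⁴` the germ `L ∘ ρ` (det `= -det L`; `L` a reflection gives the `det > 0` endpoint `R ∘ ι` of
Disproof §8) satisfies `CreaseMeanConvexAt` at every unit `u`. [folklore] -/
theorem creaseMeanConvexAt_isometry_comp_roundModel (L : E4 ≃ₗᵢ[ℝ] E4) {u : E4} (hu : ‖u‖ = 1) :
    CreaseMC[(⇑L ∘ ρ), u] :=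
  creaseMeanConvexAt_comp_isometry L (creaseMeanConvexAt_roundModel hu)

/-! ### Non-vacuity of the frame quantifier, and a germ that FAILS the predicate -/

/-- **The frame quantifier of `CreaseMeanConvexAt` is never vacuous at an invertible derivative**:
for `‖u‖ = 1` and a linear automorphism `A` of `ℝ⁴` some tangent frame `w ⊥ u` has `A w` orthonormal
(orthonormalise inside `A(u^⊥)`, pull back by `A⁻¹`). [folklore] -/
theorem exists_tangentFrame_orthonormal_image {u : E4} (hu : ‖u‖ = 1) (A : E4 ≃L[ℝ] E4) :
    ∃ w : Fin 3 → E4, (∀ i, ⟪w i, u⟫ = 0) ∧ Orthonormal ℝ (fun i => A (w i)) := by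
  haveI : Fact (Module.finrank ℝ E4 = 3 + 1) := ⟨by simp⟩
  have hu0 : u ≠ 0 := by
    intro h; rw [h, norm_zero] at hu; exact zero_ne_one hu
  set K : Submodule ℝ E4 := (ℝ ∙ u)ᗮ with hK
  set V : Submodule ℝ E4 := K.map (A.toLinearEquiv : E4 →ₗ[ℝ] E4) with hV
  have hKdim : Module.finrank ℝ K = 3 := Submodule.finrank_orthogonal_span_singleton hu0
  have hVdim : Module.finrank ℝ V = 3 := by
    rw [hV, LinearEquiv.finrank_map_eq]; exact hKdim
  let b : OrthonormalBasis (Fin 3) ℝ V := (stdOrthonormalBasis ℝ V).reindex (finCongr hVdim)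
  refine ⟨fun i => A.symm (b i : E4), fun i => ?_, ?_⟩
  · have hmem : ((b i : V) : E4) ∈ K.map (A.toLinearEquiv : E4 →ₗ[ℝ] E4) := (b i).2
    rw [Submodule.mem_map] at hmem
    obtain ⟨k, hk, hkeq⟩ := hmem
    have hk' : A.symm (b i : E4) = k := by
      rw [← hkeq]; exact A.symm_apply_apply k
    show ⟪A.symm (b i : E4), u⟫ = 0
    rw [hk', real_inner_comm]
    exact (Submodule.mem_orthogonal_singleton_iff_inner_right).mp hk
  · have h1 : (fun i => A (A.symm (b i : E4))) = (V.subtypeₗᵢ ∘ ⇑b) := by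
      funext i; simp
    rw [h1, LinearIsometry.orthonormal_comp_iff]
    exact b.orthonormal

/-- Corollary in the skeleton's shape: under `Function.Bijective (fderiv ℝ g u)` the hypotheses of
the `∀ w` in `CreaseMeanConvexAt g u` are satisfiable — a genuine inequality, never vacuous. [folklore] -/
theorem exists_tangentFrame_of_bijective_fderiv {g : E4 → E4} {u : E4} (hu : ‖u‖ = 1)
    (hg : Function.Bijective (fderiv ℝ g u)) :
    ∃ w : Fin 3 → E4, (∀ i, ⟪w i, u⟫ = 0) ∧ Orthonormal ℝ (fun i => fderiv ℝ g u (w i)) := by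
  let A : E4 ≃L[ℝ] E4 :=
    (LinearEquiv.ofBijective (fderiv ℝ g u).toLinearMap hg).toContinuousLinearEquiv
  obtain ⟨w, hw, horth⟩ := exists_tangentFrame_orthonormal_image hu A
  exact ⟨w, hw, horth⟩

/-- **A local-diffeomorphism germ whose crease is NOT mean-convex**: the identity germ (unit sphere
seen from OUTSIDE the ball; `3 < 0`) — `CreaseMeanConvexAt` is not trivially true. [folklore] -/
theorem not_creaseMeanConvexAt_id {u : E4} (hu : ‖u‖ = 1) : ¬ CreaseMC[(fun x : E4 => x), u] := by
  intro h
  obtain ⟨w, hw, horth⟩ :=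
    exists_tangentFrame_orthonormal_image hu (ContinuousLinearEquiv.refl ℝ E4)
  have hfd : ∀ x : E4, fderiv ℝ (fun x : E4 => x) x = ContinuousLinearMap.id ℝ E4 :=
    fun x => fderiv_fun_id
  have hc : ∀ i, fderiv ℝ (fun x : E4 => fderiv ℝ (fun x : E4 => x) x (w i)) u (w i) = 0 := by
    intro i
    have : (fun x : E4 => fderiv ℝ (fun x : E4 => x) x (w i)) = fun _ => w i := by
      funext x; simp [hfd]
    rw [this]
    simp
  have key := h w hw (by simpa [hfd] using horth)
  simp only [hc, map_zero, inner_zero_left, Finset.sum_const_zero] at key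
  exact absurd key (not_lt.mpr (Finset.sum_nonneg fun i _ => sq_nonneg _))

/-- The identity family is smooth and regular with ROUND final crease (`dist u 0 = 1`) yet is not a
mean-convex unwinding: roundness of `g 1` alone does not give `IsMeanConvexUnwinding`. [folklore] -/
theorem not_isMeanConvexUnwinding_const_id : ¬ MCUnwinding[(fun (_ : ℝ) (x : E4) => x), 0, 1] := by
  intro h
  have hu : ‖(EuclideanSpace.single 0 1 : E4)‖ = 1 := by simp
  exact not_creaseMeanConvexAt_id hu (h.1 0 (by norm_num) _ hu).2.2

/-! ### No degenerate endpoint: the final radius of a mean-convex unwinding is positive -/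

/-- **`r > 0` is forced by `IsMeanConvexUnwinding g c r`** (body verbatim): if `r ≤ 0` then `g 1` is
constant `= c` on the unit sphere, so its derivative at `e₀` kills the tangent vector `e₁` (differentiate
along the great circle `cos s • e₀ + sin s • e₁`), contradicting `Function.Bijective (fderiv ℝ (g 1) e₀)`.
So the degenerate instances `r = 0` / `r < 0` of stubs 3–5 are excluded by the hypotheses themselves,
as the skeleton's docstring claims. [folklore] -/
theorem radius_pos_of_isMeanConvexUnwinding {g : ℝ → E4 → E4} {c : E4} {r : ℝ}
    (h : MCUnwinding[g, c, r]) : 0 < r := by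
  obtain ⟨hreg, hround⟩ := h
  set u₀ : E4 := EuclideanSpace.single 0 1 with hu₀def
  set w : E4 := EuclideanSpace.single 1 1 with hwdef
  have hu₀ : ‖u₀‖ = 1 := by simp [hu₀def]
  have hw : ‖w‖ = 1 := by simp [hwdef]
  have huw : ⟪u₀, w⟫ = 0 := by
    simp [hu₀def, hwdef, EuclideanSpace.inner_single_left]
  have hr0 : 0 ≤ r := by rw [← hround u₀ hu₀]; exact dist_nonneg
  rcases hr0.lt_or_eq with hpos | hzero
  · exact hpos
  exfalso
  -- `r = 0`: `g 1` is constant `= c` on the unit sphere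
  have hconst : ∀ u : E4, ‖u‖ = 1 → g 1 u = c := fun u hu => by
    have := hround u hu; rw [← hzero] at this; exact dist_eq_zero.mp this
  -- the great circle through `u₀` with velocity `w`
  set γ : ℝ → E4 := fun s => Real.cos s • u₀ + Real.sin s • w with hγdef
  have hγnorm : ∀ s, ‖γ s‖ = 1 := by
    intro s
    have hsq : ‖γ s‖ ^ 2 = 1 := by
      rw [hγdef]
      simp only
      rw [norm_add_sq_real, norm_smul, norm_smul, hu₀, hw, inner_smul_left, inner_smul_right, huw,
        Real.norm_eq_abs, Real.norm_eq_abs, mul_one, mul_one, sq_abs, sq_abs]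
      simp [Real.cos_sq_add_sin_sq]
    exact (pow_eq_one_iff_of_nonneg (norm_nonneg _) two_ne_zero).mp hsq
  have hγ0 : γ 0 = u₀ := by simp [hγdef]
  have hγ' : HasDerivAt γ w 0 := by
    have h1 := ((Real.hasDerivAt_cos 0).smul_const u₀).add ((Real.hasDerivAt_sin 0).smul_const w)
    simp only [Real.sin_zero, neg_zero, zero_smul, Real.cos_zero, one_smul, zero_add] at h1
    exact h1
  -- `g 1` is differentiable at `u₀`
  have hdiff : DifferentiableAt ℝ (g 1) u₀ := by
    have hcd : ContDiffAt ℝ ∞ (Function.uncurry g) (1, u₀) :=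
      (hreg 1 (by norm_num) u₀ hu₀).1
    have hcomp : ContDiffAt ℝ ∞ (Function.uncurry g ∘ fun x : E4 => ((1 : ℝ), x)) u₀ :=
      hcd.comp u₀ (contDiffAt_const.prodMk contDiffAt_id)
    exact hcomp.differentiableAt (by simp)
  have hchain : HasDerivAt (g 1 ∘ γ) (fderiv ℝ (g 1) u₀ w) 0 := by
    have hl : HasFDerivAt (g 1) (fderiv ℝ (g 1) u₀) (γ 0) := by
      rw [hγ0]; exact hdiff.hasFDerivAt
    exact hl.comp_hasDerivAt 0 hγ'
  have hcirc : (g 1 ∘ γ) = fun _ => c := funext fun s => hconst (γ s) (hγnorm s)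
  rw [hcirc] at hchain
  have hzero' : fderiv ℝ (g 1) u₀ w = 0 := by
    have := hchain.unique (hasDerivAt_const 0 c)
    exact this
  have hinj := (hreg 1 (by norm_num) u₀ hu₀).2.1.1
  have hw0 : w = 0 := hinj (by rw [hzero', map_zero])
  have : ‖w‖ = 0 := by rw [hw0, norm_zero]
  rw [hw] at this
  exact one_ne_zero this

end Summit.SmoothPoincare4.SmoothPoincare4.Theorems.OrigamiFoldExistence.Negative

end
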